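/-
Soundness of the SEEDCERT kernel certificates (`SrwSeedCertKernel`, `SrwSeedCertSemantics`):
`Cert.check = true` (its four conjuncts) implies the real enclosure `lo n ≤ I_{n,0}(x; 11) ≤ hi n`, `1 ≤ n ≤ 4`.
-/
import Literature.Probability.FitznerVanDerHofstad2017.SrwSeedCertSemantics
import Literature.Probability.LatticeModels.SRWHeatKernelBracketList
import Literature.Probability.LatticeModels.LatticePotentialKernelBounds
import Literature.NumberTheory.LFunctions.WeilSharpConstants

/-!
# SEEDCERT soundness: a passing certificate encloses the seed integrals `I_{n,0}(x; 11)`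

This file proves, once and for all certificates `c : SeedCert.Cert` (see `SrwSeedCertKernel` for the exact
rational arithmetic and `SrwSeedCertSemantics` for the meaning of each kernel quantity), the SOUNDNESS THEOREM

* `SeedCert.Cert.sound` — if `c.paramsOK`, `c.poissonCheck`, `c.tailCheck`, `c.finalCheck` all evaluate to `true`
  and `x : Fin 11 → ℤ` has coordinate moduli `c.avals`, then for `1 ≤ n ≤ 4`
  `((c.lo n : ℚ) : ℝ) ≤ srwI 11 n 0 x ∧ srwI 11 n 0 x ≤ ((c.hi n : ℚ) : ℝ)`.

The argument is the one of [FitznerVanDerHofstad2016NoBLE, §5.1.1 (5.4)–(5.5) pp. 1089–1090] made rigorous with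
explicit two-sided error terms:  `I_{n,0}(x) = d^n/(n-1)! ∫₀^∞ u^{n-1} ∏_μ q_u(x_μ) du` (`srwI_succ_zero_eq_integral_Ioc_add_integral_Ioi`)
is split at `T = t²`.

* Layer A (`[0,T]`): the Bessel/EGF expansion of `∏_μ q_u(x_μ)` in closed walks (`SrwIntegralBesselUSplit`) turns the
  head integral into a finite Poisson-weighted walk sum `P − e^{-λ} U` (`λ = 11 t²`; kernel quantities `Pq`, `Uq`, checked
  against `pLo/pHi/uLo/uHi` by `poissonCheck`) plus a nonnegative remainder bounded by a geometric Poisson-tail majorant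
  (`poissonTail_le_geom`, `tsum_choose_mul_poissonTail_le`; kernel quantity `Rplus`); `e^{-λ}` is bracketed by powers of a
  32-term enclosure of `e^{-1}` (`exp_neg_nat_mem`).
* Layers B/C (`[T,∞)`): each factor `√(2πu) q_u(a)` is enclosed between two polynomials in `1/u` with rational-times-`√`-free
  coefficients (`srwHeatKernel_bracket_eps_coeffQ` of `SRWHeatKernelBracketList`, with the `ε`-slack `c.eps a` dominating the
  explicit bracket constant — `paramsOK`); the product of the eleven lower (resp. upper) polynomials, scaled by `2^{11 S}` and
  rounded outward to natural-number coefficient pairs (`plPN`, `puPN`, `SrwSeedCertSemantics`), is integrated termwise against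
  `u^{n-1-11/2}` over `[t², ∞)` in closed form (`integral_rpow_tail`), giving the kernel quantities `IL/IU` checked against
  `ilLo/iuHi` by `tailCheck`; the constant `(2π)^{-11/2}` is enclosed via `piLo < π < piHi` (the landed 20-digit enclosure `LFunctions.piLo20_lt` /
  `LFunctions.lt_piHi20` of `WeilSharpConstants` — same literals) and `sLo² ≤ 2π ≤ sHi²`.
* `finalCheck` compares `lo n`/`hi n` with the assembled rational lower/upper bounds; `Cert.sound` chains the three layers.

No hypothesis of this file is programme-internal: everything is kernel-proved here or in the imported (sorry-free) modules.
-/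


namespace Literature.Probability.FitznerVanDerHofstad2017.SeedCert

open Real MeasureTheory Set Finset Polynomial
open scoped Nat

/-! ### Analytic layer A: `e^{-λ}` brackets and the Poisson-tail majorant -/

/-- `expNegOneLo ≤ e^{-1} ≤ expNegOneHi` (`Real.exp_bound` with 32 terms). [folklore] -/
theorem exp_neg_one_mem :
    ((expNegOneLo : ℚ) : ℝ) ≤ Real.exp (-1) ∧ Real.exp (-1) ≤ ((expNegOneHi : ℚ) : ℝ) := by
  have hb := Real.exp_bound (x := (-1 : ℝ)) (by norm_num) (n := 32) (by norm_num)
  rw [abs_sub_le_iff] at hb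
  obtain ⟨h1, h2⟩ := hb
  have hS : ((expNegOnePartial 32 : ℚ) : ℝ) = ∑ i ∈ range 32, (-1 : ℝ) ^ i / (i ! : ℝ) := by
    rw [expNegOnePartial]; push_cast; rfl
  have hB : ((expNegOneErr 32 : ℚ) : ℝ) = |(-1 : ℝ)| ^ 32 * ((Nat.succ 32 : ℕ) / ((32 : ℕ)! * (32 : ℕ) : ℝ)) := by
    rw [expNegOneErr]; push_cast; norm_num
  constructor
  · rw [expNegOneLo, Rat.cast_sub, hS, hB]; linarith
  · rw [expNegOneHi, Rat.cast_add, hS, hB]; linarith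

/-- `expNegOneLo^λ ≤ e^{-λ} ≤ expNegOneHi^λ` for natural `λ`. [folklore] -/
theorem exp_neg_nat_mem (lam : ℕ) (hlo : 0 ≤ expNegOneLo) :
    ((expNegOneLo ^ lam : ℚ) : ℝ) ≤ Real.exp (-(lam : ℝ)) ∧
      Real.exp (-(lam : ℝ)) ≤ ((expNegOneHi ^ lam : ℚ) : ℝ) := by
  have he : Real.exp (-(lam : ℝ)) = Real.exp (-1) ^ lam := by
    rw [← Real.exp_nat_mul]; congr 1; ring
  obtain ⟨h1, h2⟩ := exp_neg_one_mem
  rw [he]; push_cast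
  exact ⟨pow_le_pow_left₀ (by exact_mod_cast hlo) h1 lam,
    pow_le_pow_left₀ (Real.exp_nonneg _) h2 lam⟩

/-- **Geometric majorant of the Poisson tail**: for `0 ≤ λ < k+1`,
`Q(λ,k) ≤ e^{-λ} λ^k/k! · (k+1)/(k+1-λ)` (from `k!(k+1)^j ≤ (k+j)!`). [folklore] -/
theorem poissonTail_le_geom {lam : ℝ} (hlam : 0 ≤ lam) {k : ℕ} (hk : lam < k + 1) :
    poissonTail lam k ≤ Real.exp (-lam) * (lam ^ k / (k ! : ℝ) * ((k + 1) / (k + 1 - lam))) := by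
  have hE := hasSum_pow_div_factorial_exp lam
  have htail : HasSum (fun j : ℕ => lam ^ (j + k) / ((j + k)! : ℝ))
      (Real.exp lam - expPartial lam k) := (hasSum_nat_add_iff' k).mpr hE
  have hk1 : (0 : ℝ) < k + 1 := by positivity
  set q : ℝ := lam / (k + 1) with hq
  have hq0 : 0 ≤ q := div_nonneg hlam hk1.le
  have hq1 : q < 1 := (div_lt_one hk1).mpr hk
  have hgeom : HasSum (fun j : ℕ => lam ^ k / (k ! : ℝ) * q ^ j)
      (lam ^ k / (k ! : ℝ) * (1 - q)⁻¹) :=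
    (hasSum_geometric_of_lt_one hq0 hq1).mul_left _
  have hle : ∀ j : ℕ, lam ^ (j + k) / ((j + k)! : ℝ) ≤ lam ^ k / (k ! : ℝ) * q ^ j := by
    intro j
    have hf : (k ! : ℝ) * ((k : ℝ) + 1) ^ j ≤ ((j + k)! : ℝ) := by
      have := Nat.factorial_mul_pow_le_factorial (m := k) (n := j)
      rw [show k + j = j + k from Nat.add_comm k j] at this
      exact_mod_cast this
    rw [hq, div_pow, pow_add, div_mul_div_comm,
      div_le_div_iff₀ (by positivity) (by positivity)]
    calc lam ^ j * lam ^ k * ((k ! : ℝ) * ((k : ℝ) + 1) ^ j)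
        ≤ lam ^ j * lam ^ k * ((j + k)! : ℝ) :=
          mul_le_mul_of_nonneg_left hf (by positivity)
      _ = lam ^ k * lam ^ j * ((j + k)! : ℝ) := by ring
  have hsum_le := hasSum_le hle htail hgeom
  have hpt : poissonTail lam k = Real.exp (-lam) * (Real.exp lam - expPartial lam k) := by
    rw [poissonTail, mul_sub, ← Real.exp_add, neg_add_cancel, Real.exp_zero]
  rw [hpt]
  refine mul_le_mul_of_nonneg_left ?_ (Real.exp_nonneg _)
  have h1q : (1 - q)⁻¹ = (k + 1) / (k + 1 - lam) := by
    have hne : (k : ℝ) + 1 - lam ≠ 0 := by linarith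
    rw [hq, inv_eq_iff_eq_inv, inv_div]
    field_simp
  calc Real.exp lam - expPartial lam k ≤ lam ^ k / (k ! : ℝ) * (1 - q)⁻¹ := hsum_le
    _ = lam ^ k / (k ! : ℝ) * ((k + 1) / (k + 1 - lam)) := by rw [h1q]

/-- For `0 ≤ λ < a ≤ b`: `b/(b-λ) ≤ a/(a-λ)`. [folklore] -/
theorem div_sub_antitone {lam a b : ℝ} (hlam : 0 ≤ lam) (ha : lam < a) (hab : a ≤ b) :
    b / (b - lam) ≤ a / (a - lam) := by
  rw [div_le_div_iff₀ (by linarith) (by linarith)]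
  nlinarith

/-- **Majorant of the Poisson-tail remainder**: for `0 ≤ λ < M+1`,
`Σ_{m≥0} C(m+M+n,n) Q(λ, m+M+n+1) ≤ e^{-λ} · θ θ' λ^{M+n+1}/(n! M! (M+n+1))`,
`θ = (M+n+2)/(M+n+2-λ)`, `θ' = (M+1)/(M+1-λ)` (and the series is summable). [folklore] -/
theorem tsum_choose_mul_poissonTail_le {lam : ℝ} (hlam : 0 ≤ lam) (M n : ℕ)
    (hM : lam < M + 1) :
    Summable (fun m : ℕ => (((m + M + n).choose n : ℕ) : ℝ) * poissonTail lam (m + M + n + 1)) ∧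
      ∑' m : ℕ, (((m + M + n).choose n : ℕ) : ℝ) * poissonTail lam (m + M + n + 1)
        ≤ Real.exp (-lam) * ((((M : ℝ) + n + 2) / ((M : ℝ) + n + 2 - lam))
            * (((M : ℝ) + 1) / ((M : ℝ) + 1 - lam))
            * lam ^ (M + n + 1) / ((n ! : ℝ) * (M ! : ℝ) * ((M : ℝ) + n + 1))) := by
  set θ : ℝ := ((M : ℝ) + n + 2) / ((M : ℝ) + n + 2 - lam) with hθ
  set q : ℝ := lam / ((M : ℝ) + 1) with hq
  have hM1 : (0 : ℝ) < (M : ℝ) + 1 := by positivity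
  have hq0 : 0 ≤ q := div_nonneg hlam hM1.le
  have hq1 : q < 1 := (div_lt_one hM1).mpr hM
  have hθ0 : 0 ≤ θ := div_nonneg (by positivity) (by linarith)
  set D : ℝ := lam ^ (M + n + 1) / ((n ! : ℝ) * ((M : ℝ) + n + 1) * (M ! : ℝ)) with hD
  have hD0 : 0 ≤ D := by positivity
  set f : ℕ → ℝ := fun m => (((m + M + n).choose n : ℕ) : ℝ) * poissonTail lam (m + M + n + 1)
    with hf
  set g : ℕ → ℝ := fun m => Real.exp (-lam) * θ * D * q ^ m with hg
  have hgsum : HasSum g (Real.exp (-lam) * θ * D * (1 - q)⁻¹) :=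
    (hasSum_geometric_of_lt_one hq0 hq1).mul_left _
  have hf0 : ∀ m, 0 ≤ f m := fun m =>
    mul_nonneg (Nat.cast_nonneg _) (poissonTail_nonneg hlam _)
  -- the combinatorial inequality
  have hcomb : ∀ m : ℕ, (((m + M + n).choose n : ℕ) : ℝ)
      * (lam ^ (m + M + n + 1) / ((m + M + n + 1)! : ℝ)) ≤ D * q ^ m := by
    intro m
    have hC : (((m + M + n).choose n : ℕ) : ℝ)
        = ((m + M + n)! : ℝ) / (((m + M)! : ℝ) * (n ! : ℝ)) := by
      rw [eq_div_iff (by positivity), ← mul_assoc]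
      exact_mod_cast Nat.add_choose_mul_factorial_mul_factorial (m + M) n
    have hfs : ((m + M + n + 1)! : ℝ) = (((m + M + n + 1 : ℕ) : ℝ)) * ((m + M + n)! : ℝ) := by
      rw [Nat.factorial_succ]; push_cast; ring
    have hMf : (M ! : ℝ) * ((M : ℝ) + 1) ^ m ≤ ((m + M)! : ℝ) := by
      have := Nat.factorial_mul_pow_le_factorial (m := M) (n := m)
      rw [show M + m = m + M from Nat.add_comm M m] at this
      exact_mod_cast this
    have hnat : ((M : ℝ) + n + 1) * ((M ! : ℝ) * ((M : ℝ) + 1) ^ m)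
        ≤ (((m + M + n + 1 : ℕ) : ℝ)) * ((m + M)! : ℝ) := by
      apply mul_le_mul _ hMf (by positivity) (by positivity)
      push_cast; linarith [(Nat.cast_nonneg m : (0 : ℝ) ≤ m)]
    rw [hC, hfs, hD, hq, div_pow, div_mul_div_comm, div_mul_div_comm,
      div_le_div_iff₀ (by positivity) (by positivity)]
    calc ((m + M + n)! : ℝ) * lam ^ (m + M + n + 1)
          * ((n ! : ℝ) * ((M : ℝ) + n + 1) * (M ! : ℝ) * ((M : ℝ) + 1) ^ m)
        = ((m + M + n)! : ℝ) * lam ^ (m + M + n + 1) * (n ! : ℝ)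
            * (((M : ℝ) + n + 1) * ((M ! : ℝ) * ((M : ℝ) + 1) ^ m)) := by ring
      _ ≤ ((m + M + n)! : ℝ) * lam ^ (m + M + n + 1) * (n ! : ℝ)
            * ((((m + M + n + 1 : ℕ) : ℝ)) * ((m + M)! : ℝ)) :=
          mul_le_mul_of_nonneg_left hnat (by positivity)
      _ = lam ^ (M + n + 1) * lam ^ m
            * (((m + M)! : ℝ) * (n ! : ℝ) * ((((m + M + n + 1 : ℕ) : ℝ)) * ((m + M + n)! : ℝ))) := by
          ring
  have hle : ∀ m, f m ≤ g m := by
    intro m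
    have hk : lam < ((m + M + n + 1 : ℕ) : ℝ) + 1 := by push_cast; linarith [(Nat.cast_nonneg m : (0 : ℝ) ≤ m), (Nat.cast_nonneg n : (0 : ℝ) ≤ n)]
    have h1 := poissonTail_le_geom hlam hk
    have hθk : (((m + M + n + 1 : ℕ) : ℝ) + 1) / (((m + M + n + 1 : ℕ) : ℝ) + 1 - lam) ≤ θ := by
      rw [hθ]
      apply div_sub_antitone hlam (by linarith [(Nat.cast_nonneg n : (0 : ℝ) ≤ n)])
      push_cast; linarith [(Nat.cast_nonneg m : (0 : ℝ) ≤ m)]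
    calc f m ≤ (((m + M + n).choose n : ℕ) : ℝ) * (Real.exp (-lam)
          * (lam ^ (m + M + n + 1) / ((m + M + n + 1)! : ℝ)
            * ((((m + M + n + 1 : ℕ) : ℝ) + 1) / (((m + M + n + 1 : ℕ) : ℝ) + 1 - lam)))) := by
            rw [hf]; exact mul_le_mul_of_nonneg_left (by exact_mod_cast h1) (Nat.cast_nonneg _)
      _ ≤ (((m + M + n).choose n : ℕ) : ℝ) * (Real.exp (-lam)
          * (lam ^ (m + M + n + 1) / ((m + M + n + 1)! : ℝ) * θ)) := by
            gcongr
      _ = Real.exp (-lam) * θ * ((((m + M + n).choose n : ℕ) : ℝ)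
          * (lam ^ (m + M + n + 1) / ((m + M + n + 1)! : ℝ))) := by ring
      _ ≤ Real.exp (-lam) * θ * (D * q ^ m) :=
            mul_le_mul_of_nonneg_left (hcomb m) (mul_nonneg (Real.exp_nonneg _) hθ0)
      _ = g m := by rw [hg]; ring
  have hfsum : Summable f := Summable.of_nonneg_of_le hf0 hle hgsum.summable
  refine ⟨hfsum, ?_⟩
  have h := hasSum_le hle hfsum.hasSum hgsum
  have h1q : (1 - q)⁻¹ = ((M : ℝ) + 1) / ((M : ℝ) + 1 - lam) := by
    have hne : (M : ℝ) + 1 - lam ≠ 0 := by linarith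
    rw [hq, inv_eq_iff_eq_inv, inv_div]
    field_simp
  calc ∑' m, f m ≤ Real.exp (-lam) * θ * D * (1 - q)⁻¹ := h
    _ = _ := by rw [h1q, hθ, hD]; ring

end Literature.Probability.FitznerVanDerHofstad2017.SeedCert


namespace Literature.Probability.FitznerVanDerHofstad2017.SeedCert

open Real MeasureTheory Set Finset Polynomial
open Literature.Probability.LatticeModels (srwHeatKernel bracketCoeffQ complSum complSum_nonneg
  invSqrtCoeff_eq_cast srwHeatKernel_bracket_eps_coeffQ continuous_srwHeatKernel_left)
open Literature.Probability.FitznerVanDerHofstad2017.SrwCount (coordD)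
open Literature.Barriers.CriticalPhenomena.LongRangePhi4 (srwLaw srwLaw_nonneg srwLaw_le_one)
open scoped Nat

/-! ### Analytic layer B: casts of the rational constants -/

/-- `complSumQ` casts to `complSum`. [folklore] -/
theorem cast_complSumQ (i : ℕ) (σ r : ℚ) :
    ((complSumQ i σ r : ℚ) : ℝ) = complSum i (σ : ℝ) (r : ℝ) := by
  rw [complSumQ, complSum]; push_cast; rfl

/-- `expPartialQ` casts to `expPartial`. [folklore] -/
theorem cast_expPartialQ (y : ℚ) (N : ℕ) :
    ((expPartialQ y N : ℚ) : ℝ) = expPartial (y : ℝ) N := by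
  rw [expPartialQ, expPartial]; push_cast; rfl

/-- `0 < piLo`. [folklore] -/
theorem piLo_pos : (0 : ℝ) < ((piLo : ℚ) : ℝ) := by
  have : ((piLo : ℚ) : ℝ) = 3.14159265358979323846 := by rw [piLo]; norm_num
  rw [this]; norm_num

/-- `T^{J+3/2} = T^{J+1}·t` for `T = t²`, `t > 0`. [folklore] -/
theorem sq_rpow_J (t : ℝ) (ht : 0 < t) (J : ℕ) :
    (t ^ 2) ^ ((J : ℝ) + 3 / 2) = (t ^ 2) ^ (J + 1) * t := by
  have h2 : (0 : ℝ) < t ^ 2 := by positivity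
  rw [show ((J : ℝ) + 3 / 2) = (((J + 1 : ℕ) : ℝ) + 1 / 2) by push_cast; ring,
    Real.rpow_add h2, Real.rpow_natCast, ← Real.sqrt_eq_rpow, Real.sqrt_sq ht.le]

namespace Cert

variable (c : Cert) {x : Fin 11 → ℤ}

/-- Unpacking of `poissonCheck`. [folklore] -/
theorem poissonCheck_spec (h : c.poissonCheck = true) (n : ℕ) (hn1 : 1 ≤ n) (hn4 : n ≤ 4) :
    c.pLo n ≤ c.Pq c.what n ∧ c.Pq c.what n ≤ c.pHi n ∧
      c.uLo n ≤ c.Uq c.what n ∧ c.Uq c.what n ≤ c.uHi n := by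
  simp only [poissonCheck, List.all_eq_true, List.mem_range, Bool.and_eq_true,
    decide_eq_true_eq] at h
  obtain ⟨⟨⟨a1, a2⟩, a3⟩, a4⟩ := h (n - 1) (by omega)
  rw [show n - 1 + 1 = n by omega] at a1 a2 a3 a4
  exact ⟨a1, a2, a3, a4⟩

/-- Unpacking of `tailCheck`. [folklore] -/
theorem tailCheck_spec (h : c.tailCheck = true) (n : ℕ) (hn1 : 1 ≤ n) (hn4 : n ≤ 4) :
    c.ilLo n ≤ c.tailOf c.plPN n ∧ c.tailOf c.puPN n ≤ c.iuHi n := by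
  simp only [tailCheck, List.all_eq_true, List.mem_range, Bool.and_eq_true,
    decide_eq_true_eq] at h
  obtain ⟨a1, a2⟩ := h (n - 1) (by omega)
  rw [show n - 1 + 1 = n by omega] at a1 a2
  exact ⟨a1, a2⟩

/-- Unpacking of `finalCheck`. [folklore] -/
theorem finalCheck_spec (h : c.finalCheck = true) (n : ℕ) (hn1 : 1 ≤ n) (hn4 : n ≤ 4) :
    0 ≤ c.uLo n ∧ 0 ≤ c.ilLo n ∧ c.lo n ≤ c.loFinal n ∧ c.hiFinal n ≤ c.hi n := by
  simp only [finalCheck, List.all_eq_true, List.mem_range, Bool.and_eq_true,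
    decide_eq_true_eq] at h
  obtain ⟨⟨⟨a1, a2⟩, a3⟩, a4⟩ := h (n - 1) (by omega)
  rw [show n - 1 + 1 = n by omega] at a1 a2 a3 a4
  exact ⟨a1, a2, a3, a4⟩

/-- `λ = 11 t²` in `ℝ`. [folklore] -/
theorem cast_lam : ((11 : ℕ) : ℝ) * ((c.t : ℝ) ^ 2) = ((c.lam : ℕ) : ℝ) := by
  rw [Cert.lam]; push_cast; ring

/-- The real form of `R⁺_{n'+1}`. [folklore] -/
theorem Rplus_real (n' : ℕ) :
    ((c.Rplus (n' + 1) : ℚ) : ℝ) = ((c.rHi : ℚ) : ℝ) *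
      ((((c.M (n' + 1) : ℝ) + n' + 2) / ((c.M (n' + 1) : ℝ) + n' + 2 - (c.lam : ℝ)))
        * (((c.M (n' + 1) : ℝ) + 1) / ((c.M (n' + 1) : ℝ) + 1 - (c.lam : ℝ)))
        * (c.lam : ℝ) ^ (c.M (n' + 1) + n' + 1)
          / ((n' ! : ℝ) * ((c.M (n' + 1))! : ℝ) * ((c.M (n' + 1) : ℝ) + n' + 1))) := by
  rw [Rplus]
  push_cast
  ring

/-- **The `[0,T]` block**: with `B₀ = 11^{n'+1}/n'! ∫_{(0,T]} u^{n'} ∏_μ q_u(x_μ) du`,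
`P - e^{-λ} U ≤ B₀ ≤ P - e^{-λ} U + R⁺`. [folklore] -/
theorem ioc_block (hp : c.Params) (hcs : ∀ i, coordD x i = ((c.avals.getD i 0 : ℕ) : ℤ))
    (n' : ℕ) (hn : n' ≤ 3) :
    ((c.Pq c.what (n' + 1) : ℚ) : ℝ) - Real.exp (-(c.lam : ℝ)) * ((c.Uq c.what (n' + 1) : ℚ) : ℝ)
      ≤ (11 : ℝ) ^ (n' + 1) / (n' ! : ℝ)
          * ∫ u in Ioc 0 ((c.t : ℝ) ^ 2), u ^ n' * ∏ μ : Fin 11, srwHeatKernel u (x μ) ∧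
    (11 : ℝ) ^ (n' + 1) / (n' ! : ℝ)
          * ∫ u in Ioc 0 ((c.t : ℝ) ^ 2), u ^ n' * ∏ μ : Fin 11, srwHeatKernel u (x μ)
      ≤ ((c.Pq c.what (n' + 1) : ℚ) : ℝ) - Real.exp (-(c.lam : ℝ)) * ((c.Uq c.what (n' + 1) : ℚ) : ℝ)
          + ((c.Rplus (n' + 1) : ℚ) : ℝ) := by
  have hn1 : 1 ≤ n' + 1 := by omega
  have hn4 : n' + 1 ≤ 4 := by omega
  have hT : (0 : ℝ) ≤ (c.t : ℝ) ^ 2 := by positivity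
  have hd : 2 * n' + 3 ≤ 11 := by omega
  have hlam := c.cast_lam
  have hlam0 : (0 : ℝ) ≤ (c.lam : ℝ) := Nat.cast_nonneg _
  -- the finite Poisson-weighted sum is `P - e^{-λ} U`
  have hS : ∑ m ∈ range (c.M (n' + 1)), (((m + n').choose n' : ℕ) : ℝ) * srwLaw 11 m x
        * poissonTail ((c.lam : ℕ) : ℝ) (m + n' + 1)
      = ((c.Pq c.what (n' + 1) : ℚ) : ℝ)
        - Real.exp (-(c.lam : ℝ)) * ((c.Uq c.what (n' + 1) : ℚ) : ℝ) := by
    rw [c.Pq_real hp hcs (n' + 1) hn1 hn4, c.Uq_real hp hcs (n' + 1) hn1 hn4]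
    simp only [Nat.add_sub_cancel, poissonTail]
    rw [Finset.mul_sum, ← Finset.sum_sub_distrib]
    exact sum_congr rfl fun m _ => by ring
  have hlow := sum_choose_mul_srwLaw_mul_poissonTail_le n' hd x hT (c.M (n' + 1))
  rw [hlam, hS] at hlow
  have hMlt : (c.lam : ℝ) < (c.M (n' + 1) : ℝ) + 1 := by
    have := hp.lam_lt (n' + 1) hn1 hn4
    exact_mod_cast (by omega : c.lam < c.M (n' + 1) + 1)
  obtain ⟨hsum, hbd⟩ := tsum_choose_mul_poissonTail_le hlam0 (c.M (n' + 1)) n' hMlt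
  have hup := integral_Ioc_le_sum_add_of_hasSum n' hd x hT (c.M (n' + 1))
    (R := ∑' m : ℕ, (((m + c.M (n' + 1) + n').choose n' : ℕ) : ℝ)
      * poissonTail (c.lam : ℝ) (m + c.M (n' + 1) + n' + 1))
    (by rw [hlam]; exact hsum.hasSum)
  rw [hlam, hS] at hup
  refine ⟨by simpa using hlow, ?_⟩
  have hR : ∑' m : ℕ, (((m + c.M (n' + 1) + n').choose n' : ℕ) : ℝ)
      * poissonTail (c.lam : ℝ) (m + c.M (n' + 1) + n' + 1) ≤ ((c.Rplus (n' + 1) : ℚ) : ℝ) := by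
    refine hbd.trans ?_
    rw [c.Rplus_real n']
    obtain ⟨_, hrhi⟩ := exp_neg_nat_mem c.lam hp.eLo_nonneg
    have hrhi' : Real.exp (-(c.lam : ℝ)) ≤ ((c.rHi : ℚ) : ℝ) := by simpa [Cert.rHi] using hrhi
    apply mul_le_mul_of_nonneg_right hrhi'
    have h1 : (0 : ℝ) < (c.M (n' + 1) : ℝ) + n' + 2 - (c.lam : ℝ) := by
      linarith [(Nat.cast_nonneg n' : (0 : ℝ) ≤ n')]
    have h2 : (0 : ℝ) < (c.M (n' + 1) : ℝ) + 1 - (c.lam : ℝ) := by linarith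
    positivity
  have := hup.trans (add_le_add le_rfl hR)
  simpa using this

/-! ### Analytic layer C: the `[T,∞)` block -/

/-- A coordinate value of the certificate lies in `avals`. [folklore] -/
theorem getD_mem_avals (hp : c.Params) {i : ℕ} (hi : i < 11) : c.avals.getD i 0 ∈ c.avals := by
  have hi' : i < c.avals.length := by rw [c.length_avals hp]; exact hi
  rw [List.getD_eq_getElem?_getD, List.getElem?_eq_getElem hi', Option.getD_some]
  exact List.getElem_mem hi'

/-- The coordinates of `x` are the (cast) `avals`. [folklore] -/
theorem x_eq (hcs : ∀ i, coordD x i = ((c.avals.getD i 0 : ℕ) : ℤ)) (μ : Fin 11) :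
    x μ = ((c.avals.getD μ.val 0 : ℕ) : ℤ) := by
  have h := hcs μ.val
  simpa [coordD, μ.isLt] using h

/-- The bracket constant of `srwHeatKernel_bracket_eps_coeffQ` at `T₀ = t²` is at most `eps a`. [folklore] -/
theorem bracketConst_le (hp : c.Params) {a : ℕ} (ha : a ∈ c.avals) :
    invSqrtCoeff (c.J + 1) / (1 - ((c.s0 : ℚ) : ℝ) ^ 2) * ((2 * c.J + 1)‼ : ℝ) / 4 ^ (c.J + 1)
      + √(2 * π) * Real.exp (-(2 * ((c.t : ℝ) ^ 2) * ((c.s0 : ℚ) : ℝ) ^ 2))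
        * ((c.t : ℝ) ^ 2) ^ ((c.J : ℝ) + 3 / 2)
        * (1 + 2 / π * ∑ i ∈ range (a + c.J + 1), |((bracketCoeffQ a c.J i : ℚ) : ℝ)|
            * (1 / (2 * ((c.s0 : ℚ) : ℝ)) * complSum i (((c.s0 : ℚ) : ℝ) ^ 2) (2 * (c.t : ℝ) ^ 2)))
      ≤ ((c.eps a : ℚ) : ℝ) := by
  have heps := hp.eps_ge a ha
  have heps' : ((epsBoundQ a c.J c.s0 c.t c.sHi c.nexp : ℚ) : ℝ) ≤ ((c.eps a : ℚ) : ℝ) := by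
    exact_mod_cast heps
  refine le_trans ?_ heps'
  rw [epsBoundQ]
  push_cast
  simp only [cast_complSumQ, cast_expPartialQ, ← invSqrtCoeff_eq_cast]
  push_cast
  have ht : (0 : ℝ) < (c.t : ℝ) := by exact_mod_cast hp.t_pos
  have hs0 : (0 : ℝ) < ((c.s0 : ℚ) : ℝ) := by exact_mod_cast hp.s0_pos
  rw [sq_rpow_J (c.t : ℝ) ht c.J]
  refine add_le_add le_rfl ?_
  -- second term, factor by factor
  have hSum0 : 0 ≤ ∑ i ∈ range (a + c.J + 1), |((bracketCoeffQ a c.J i : ℚ) : ℝ)|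
      * (1 / (2 * ((c.s0 : ℚ) : ℝ)) * complSum i (((c.s0 : ℚ) : ℝ) ^ 2) (2 * (c.t : ℝ) ^ 2)) := by
    apply sum_nonneg
    intro i _
    apply mul_nonneg (abs_nonneg _)
    apply mul_nonneg (by positivity)
    exact complSum_nonneg i (by positivity) (by positivity)
  have hsHi : √(2 * π) ≤ ((c.sHi : ℚ) : ℝ) := by
    have h1 : 2 * π ≤ ((c.sHi : ℚ) : ℝ) ^ 2 := by
      have := hp.sHi_sq
      have h2 : ((2 * piHi : ℚ) : ℝ) ≤ ((c.sHi ^ 2 : ℚ) : ℝ) := by exact_mod_cast this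
      push_cast at h2
      linarith [(show Real.pi < ((piHi : ℚ) : ℝ) from Literature.NumberTheory.LFunctions.lt_piHi20)]
    have hpos : (0 : ℝ) ≤ ((c.sHi : ℚ) : ℝ) := by exact_mod_cast hp.sHi_pos.le
    calc √(2 * π) ≤ √(((c.sHi : ℚ) : ℝ) ^ 2) := Real.sqrt_le_sqrt h1
      _ = ((c.sHi : ℚ) : ℝ) := Real.sqrt_sq hpos
  have hy : (0 : ℝ) ≤ 2 * (c.t : ℝ) ^ 2 * ((c.s0 : ℚ) : ℝ) ^ 2 := by positivity
  have hE0 : 0 < expPartial (2 * (c.t : ℝ) ^ 2 * ((c.s0 : ℚ) : ℝ) ^ 2) c.nexp := by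
    obtain ⟨k, hk⟩ : ∃ k, c.nexp = k + 1 := ⟨c.nexp - 1, by have := hp.nexp_pos; omega⟩
    rw [hk, expPartial, Finset.sum_range_succ']
    simp only [pow_zero, Nat.factorial_zero, Nat.cast_one, div_one]
    have : 0 ≤ ∑ i ∈ range k, (2 * (c.t : ℝ) ^ 2 * ((c.s0 : ℚ) : ℝ) ^ 2) ^ (i + 1) / ((i + 1)! : ℝ) :=
      sum_nonneg fun i _ => by positivity
    linarith
  have hexp : Real.exp (-(2 * (c.t : ℝ) ^ 2 * ((c.s0 : ℚ) : ℝ) ^ 2))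
      ≤ 1 / expPartial (2 * (c.t : ℝ) ^ 2 * ((c.s0 : ℚ) : ℝ) ^ 2) c.nexp := by
    rw [Real.exp_neg, ← one_div]
    exact one_div_le_one_div_of_le hE0 (expPartial_le_exp hy _)
  have hpi : 2 / π ≤ 2 / ((piLo : ℚ) : ℝ) :=
    div_le_div_of_nonneg_left (by norm_num) piLo_pos (show ((piLo : ℚ) : ℝ) < Real.pi from Literature.NumberTheory.LFunctions.piLo20_lt).le
  have hA : √(2 * π) * Real.exp (-(2 * (c.t : ℝ) ^ 2 * ((c.s0 : ℚ) : ℝ) ^ 2))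
      ≤ ((c.sHi : ℚ) : ℝ) * (1 / expPartial (2 * (c.t : ℝ) ^ 2 * ((c.s0 : ℚ) : ℝ) ^ 2) c.nexp) :=
    mul_le_mul hsHi hexp (Real.exp_nonneg _) (by exact_mod_cast hp.sHi_pos.le)
  have hB : 1 + 2 / π * ∑ i ∈ range (a + c.J + 1), |((bracketCoeffQ a c.J i : ℚ) : ℝ)|
        * (1 / (2 * ((c.s0 : ℚ) : ℝ)) * complSum i (((c.s0 : ℚ) : ℝ) ^ 2) (2 * (c.t : ℝ) ^ 2))
      ≤ 1 + 2 / ((piLo : ℚ) : ℝ) * ∑ i ∈ range (a + c.J + 1), |((bracketCoeffQ a c.J i : ℚ) : ℝ)|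
        * (1 / (2 * ((c.s0 : ℚ) : ℝ)) * complSum i (((c.s0 : ℚ) : ℝ) ^ 2) (2 * (c.t : ℝ) ^ 2)) :=
    add_le_add le_rfl (mul_le_mul_of_nonneg_right hpi hSum0)
  have hP0 : (0 : ℝ) ≤ ((c.t : ℝ) ^ 2) ^ (c.J + 1) * (c.t : ℝ) := by positivity
  have hB0 : (0 : ℝ) ≤ 1 + 2 / π * ∑ i ∈ range (a + c.J + 1), |((bracketCoeffQ a c.J i : ℚ) : ℝ)|
        * (1 / (2 * ((c.s0 : ℚ) : ℝ)) * complSum i (((c.s0 : ℚ) : ℝ) ^ 2) (2 * (c.t : ℝ) ^ 2)) := by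
    positivity
  calc √(2 * π) * Real.exp (-(2 * (c.t : ℝ) ^ 2 * ((c.s0 : ℚ) : ℝ) ^ 2))
        * (((c.t : ℝ) ^ 2) ^ (c.J + 1) * (c.t : ℝ)) * _
      ≤ ((c.sHi : ℚ) : ℝ) * (1 / expPartial (2 * (c.t : ℝ) ^ 2 * ((c.s0 : ℚ) : ℝ) ^ 2) c.nexp)
        * (((c.t : ℝ) ^ 2) ^ (c.J + 1) * (c.t : ℝ)) * _ := by
        apply mul_le_mul (mul_le_mul_of_nonneg_right hA hP0) hB hB0
        exact mul_nonneg (mul_nonneg (by exact_mod_cast hp.sHi_pos.le) (by positivity)) hP0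
    _ = _ := by ring

/-- **Per-coordinate bracket**: for `u ≥ t²`, `L_a(1/u) ≤ √(2πu) q_u(a) ≤ U_a(1/u)`. [folklore] -/
theorem coord_bracket (hp : c.Params) {a : ℕ} (ha : a ∈ c.avals) {u : ℝ} (hu : (c.t : ℝ) ^ 2 ≤ u) :
    (toPolyQ (loList a c.J (c.eps a))).eval (1 / u) ≤ √(2 * π * u) * srwHeatKernel u (a : ℤ) ∧
      √(2 * π * u) * srwHeatKernel u (a : ℤ) ≤ (toPolyQ (upList a c.J (c.eps a))).eval (1 / u) := by
  have ht : (0 : ℝ) < (c.t : ℝ) := by exact_mod_cast hp.t_pos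
  have hu0 : 0 < u := lt_of_lt_of_le (by positivity) hu
  have hs0 : (0 : ℝ) < ((c.s0 : ℚ) : ℝ) := by exact_mod_cast hp.s0_pos
  have hs1 : ((c.s0 : ℚ) : ℝ) < 1 := by exact_mod_cast hp.s0_lt
  have hTc : ((c.J : ℝ) + 3 / 2) / (2 * ((c.s0 : ℚ) : ℝ) ^ 2) ≤ (c.t : ℝ) ^ 2 := by
    have h' := (Rat.cast_le (K := ℝ)).mpr hp.hT
    push_cast at h'
    exact h'
  have hb := srwHeatKernel_bracket_eps_coeffQ (u := u) hs0 hs1 (a : ℤ) c.J hTc hu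
  simp only [Int.natAbs_natCast] at hb
  have hC := c.bracketConst_le hp ha
  have hmain : ∑ i ∈ range (a + c.J + 1),
        ((bracketCoeffQ a c.J i : ℚ) : ℝ) * ((2 * i - 1)‼ : ℝ) / (4 * u) ^ i
      = ∑ i ∈ range (a + c.J + 1), ((mcoef a c.J i : ℚ) : ℝ) * (1 / u) ^ i := by
    refine sum_congr rfl fun i _ => ?_
    rw [mcoef]; push_cast
    rw [mul_pow, one_div_pow]
    field_simp
  rw [hmain] at hb
  have hw : (u ^ (c.J + 1))⁻¹ = (1 / u) ^ (c.J + 1) := by rw [one_div_pow, one_div]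
  rw [hw] at hb
  have hw0 : (0 : ℝ) ≤ (1 / u) ^ (c.J + 1) := by positivity
  rw [abs_sub_le_iff] at hb
  obtain ⟨hb1, hb2⟩ := hb
  have hEw := mul_le_mul_of_nonneg_right hC hw0
  rw [eval_toPolyQ_loList, eval_toPolyQ_upList]
  constructor <;> nlinarith [hb1, hb2, hEw]

/-- `loList` entries. [folklore] -/
theorem loList_getD {a J : ℕ} {eps : ℚ} {i : ℕ} (hi : i < blen a J) :
    (loList a J eps).getD i 0 = mcoef a J i - if i = J + 1 then eps else 0 := by
  simp [loList, List.getD_eq_getElem?_getD, List.getElem?_range hi]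

/-- **Positivity of the lower bracket polynomial** on `[0, h]` from the floor check. [folklore] -/
theorem loPoly_nonneg {a J : ℕ} {eps h : ℚ} (hfl : 0 ≤ loFloor a J eps h) {w : ℝ} (hw0 : 0 ≤ w)
    (hwh : w ≤ (h : ℝ)) : 0 ≤ (toPolyQ (loList a J eps)).eval w := by
  rw [toPolyQ_eval]
  have hlen : (loList a J eps).length = blen a J := by simp [loList]
  rw [hlen]
  have hfl' : (0 : ℝ) ≤ ((loFloor a J eps h : ℚ) : ℝ) := by exact_mod_cast hfl
  have hterm : ∀ i ∈ range (blen a J),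
      ((if i = 0 then mcoef a J 0 else 0 : ℚ) : ℝ)
        - ((if i = 0 then 0 else max 0 (-((loList a J eps).getD i 0)) * h ^ i : ℚ) : ℝ)
      ≤ (((loList a J eps).getD i 0 : ℚ) : ℝ) * w ^ i := by
    intro i hi
    rw [Finset.mem_range] at hi
    by_cases hi0 : i = 0
    · subst hi0
      rw [loList_getD hi]
      simp
    · simp only [hi0, if_false]
      push_cast
      rcases le_or_gt 0 ((((loList a J eps).getD i 0 : ℚ) : ℝ)) with hl | hl
      · rw [max_eq_left (by linarith)]
        have : 0 ≤ (((loList a J eps).getD i 0 : ℚ) : ℝ) * w ^ i := mul_nonneg hl (by positivity)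
        linarith
      · rw [max_eq_right (by linarith)]
        have hpow : w ^ i ≤ (h : ℝ) ^ i := pow_le_pow_left₀ hw0 hwh i
        nlinarith
  have hsum := Finset.sum_le_sum hterm
  refine le_trans ?_ hsum
  rw [Finset.sum_sub_distrib, ← Rat.cast_sum, ← Rat.cast_sum, Finset.sum_ite_eq', ← Rat.cast_sub]
  have h0 : 0 ∈ range (blen a J) := by simp [blen]
  rw [if_pos h0]
  have : loFloor a J eps h = mcoef a J 0
      - ∑ i ∈ range (blen a J), (if i = 0 then 0 else max 0 (-((loList a J eps).getD i 0)) * h ^ i) := by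
    rw [loFloor]
  rw [← this]
  exact hfl'

/-- A list product as a `range` product. [folklore] -/
theorem list_prod_map_eq {α M : Type*} [CommMonoid M] (f : α → M) (d : α) : ∀ l : List α,
    (l.map f).prod = ∏ i ∈ range l.length, f (l.getD i d)
  | [] => by simp
  | a :: l => by
      rw [List.map_cons, List.prod_cons, List.length_cons, prod_range_succ', list_prod_map_eq f d l]
      simp [mul_comm]

/-- The evaluated scaled product of the LOWER bracket polynomials. [folklore] -/
theorem plPN_eval (hp : c.Params) (w : ℝ) :
    (toPolyN c.plPN.1 - toPolyN c.plPN.2).eval w = (2 : ℝ) ^ (11 * c.S)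
      * ∏ μ : Fin 11, (toPolyQ (loList (c.avals.getD μ.val 0) c.J (c.eps (c.avals.getD μ.val 0)))).eval w := by
  rw [Cert.plPN, toPolyN_loProdPN]
  have hcongr : (c.avals.map fun a => toPolyZ (loListZ a c.J (c.eps a) c.S))
      = c.avals.map fun a => C ((2 : ℝ) ^ c.S) * toPolyQ (loList a c.J (c.eps a)) := by
    apply List.map_congr_left
    intro a ha
    exact toPolyZ_loListZ a c.J (c.eps a) c.S (List.all_eq_true.mpr (hp.lo_dy a ha))
  rw [hcongr, List.prod_map_mul, Polynomial.eval_mul, Polynomial.eval_list_prod,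
    Polynomial.eval_list_prod, List.map_map, List.map_map]
  have h1 : (c.avals.map (eval w ∘ fun _ : ℕ => C ((2 : ℝ) ^ c.S))).prod = (2 : ℝ) ^ (11 * c.S) := by
    rw [show (eval w ∘ fun _ : ℕ => C ((2 : ℝ) ^ c.S)) = fun _ => (2 : ℝ) ^ c.S by
      funext a; simp]
    rw [List.map_const', List.prod_replicate, c.length_avals hp, ← pow_mul, mul_comm]
  rw [h1, list_prod_map_eq _ 0, c.length_avals hp, Finset.prod_range]
  rfl

/-- The evaluated scaled product of the UPPER bracket polynomials. [folklore] -/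
theorem puPN_eval (hp : c.Params) (w : ℝ) :
    (toPolyN c.puPN.1 - toPolyN c.puPN.2).eval w = (2 : ℝ) ^ (11 * c.S)
      * ∏ μ : Fin 11, (toPolyQ (upList (c.avals.getD μ.val 0) c.J (c.eps (c.avals.getD μ.val 0)))).eval w := by
  rw [Cert.puPN, toPolyN_upProdPN]
  have hcongr : (c.avals.map fun a => toPolyZ (upListZ a c.J (c.eps a) c.S))
      = c.avals.map fun a => C ((2 : ℝ) ^ c.S) * toPolyQ (upList a c.J (c.eps a)) := by
    apply List.map_congr_left
    intro a ha
    exact toPolyZ_upListZ a c.J (c.eps a) c.S (List.all_eq_true.mpr (hp.up_dy a ha))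
  rw [hcongr, List.prod_map_mul, Polynomial.eval_mul, Polynomial.eval_list_prod,
    Polynomial.eval_list_prod, List.map_map, List.map_map]
  have h1 : (c.avals.map (eval w ∘ fun _ : ℕ => C ((2 : ℝ) ^ c.S))).prod = (2 : ℝ) ^ (11 * c.S) := by
    rw [show (eval w ∘ fun _ : ℕ => C ((2 : ℝ) ^ c.S)) = fun _ => (2 : ℝ) ^ c.S by
      funext a; simp]
    rw [List.map_const', List.prod_replicate, c.length_avals hp, ← pow_mul, mul_comm]
  rw [h1, list_prod_map_eq _ 0, c.length_avals hp, Finset.prod_range]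
  rfl

/-- **The product bracket** for `u ≥ t²`:
`PL(1/u)/2^{11S} ≤ ∏_μ √(2πu) q_u(x_μ) ≤ PU(1/u)/2^{11S}` and `0 ≤ PL(1/u)`. [folklore] -/
theorem prod_bracket (hp : c.Params) (hcs : ∀ i, coordD x i = ((c.avals.getD i 0 : ℕ) : ℤ))
    {u : ℝ} (hu : (c.t : ℝ) ^ 2 ≤ u) :
    (toPolyN c.plPN.1 - toPolyN c.plPN.2).eval (1 / u) / (2 : ℝ) ^ (11 * c.S)
        ≤ ∏ μ : Fin 11, (√(2 * π * u) * srwHeatKernel u (x μ)) ∧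
      ∏ μ : Fin 11, (√(2 * π * u) * srwHeatKernel u (x μ))
        ≤ (toPolyN c.puPN.1 - toPolyN c.puPN.2).eval (1 / u) / (2 : ℝ) ^ (11 * c.S) ∧
      0 ≤ (toPolyN c.plPN.1 - toPolyN c.plPN.2).eval (1 / u) / (2 : ℝ) ^ (11 * c.S) := by
  have ht : (0 : ℝ) < (c.t : ℝ) := by exact_mod_cast hp.t_pos
  have hu0 : 0 < u := lt_of_lt_of_le (by positivity) hu
  have hw0 : (0 : ℝ) ≤ 1 / u := by positivity
  have hwh : 1 / u ≤ ((c.h : ℚ) : ℝ) := by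
    rw [Cert.h]; push_cast
    exact one_div_le_one_div_of_le (by positivity) hu
  rw [c.plPN_eval hp, c.puPN_eval hp, mul_div_cancel_left₀ _ (by positivity),
    mul_div_cancel_left₀ _ (by positivity)]
  simp only [c.x_eq hcs]
  have hL0 : ∀ μ ∈ (univ : Finset (Fin 11)),
      0 ≤ (toPolyQ (loList (c.avals.getD μ.val 0) c.J (c.eps (c.avals.getD μ.val 0)))).eval (1 / u) := by
    intro μ _
    exact loPoly_nonneg (hp.floor_nonneg _ (c.getD_mem_avals hp μ.isLt)) hw0 hwh
  have hbr : ∀ μ ∈ (univ : Finset (Fin 11)),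
      (toPolyQ (loList (c.avals.getD μ.val 0) c.J (c.eps (c.avals.getD μ.val 0)))).eval (1 / u)
          ≤ √(2 * π * u) * srwHeatKernel u ((c.avals.getD μ.val 0 : ℕ) : ℤ) ∧
        √(2 * π * u) * srwHeatKernel u ((c.avals.getD μ.val 0 : ℕ) : ℤ)
          ≤ (toPolyQ (upList (c.avals.getD μ.val 0) c.J (c.eps (c.avals.getD μ.val 0)))).eval (1 / u) := by
    intro μ _
    exact c.coord_bracket hp (c.getD_mem_avals hp μ.isLt) hu
  refine ⟨prod_le_prod hL0 fun i hi => (hbr i hi).1, prod_le_prod (fun i hi => ?_) fun i hi => (hbr i hi).2,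
    prod_nonneg hL0⟩
  exact (hL0 i hi).trans (hbr i hi).1

end Cert

/-- `u^{n'} (1/u)^i/(u^5 √u) = u^{n' - 11/2 - i}` (`u > 0`). [folklore] -/
theorem rpow_combine {u : ℝ} (hu : 0 < u) (n' i : ℕ) :
    u ^ n' / (u ^ 5 * √u) * (1 / u) ^ i = u ^ ((n' : ℝ) - 11 / 2 - i) := by
  have e1 : u ^ ((n' : ℝ) - 11 / 2 - i) = u ^ (n' : ℝ) * (u ^ ((11 : ℝ) / 2))⁻¹ * (u ^ (i : ℝ))⁻¹ := by
    rw [show (n' : ℝ) - 11 / 2 - i = (n' : ℝ) + (-((11 : ℝ) / 2)) + (-(i : ℝ)) by ring,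
      Real.rpow_add hu, Real.rpow_add hu, Real.rpow_neg hu.le, Real.rpow_neg hu.le]
  have e2 : u ^ ((11 : ℝ) / 2) = u ^ 5 * √u := by
    rw [show (11 : ℝ) / 2 = ((5 : ℕ) : ℝ) + 1 / 2 by norm_num, Real.rpow_add hu, Real.rpow_natCast,
      Real.sqrt_eq_rpow]
  rw [e1, e2, Real.rpow_natCast, Real.rpow_natCast, one_div, inv_pow]
  ring

/-- `∫_{t²}^∞ u^{n' - 11/2 - i} du = 2/((9 - 2n' + 2i) t^{9 - 2n' + 2i})` (`n' ≤ 3`, `t > 0`). [folklore] -/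
theorem integral_rpow_tail {t : ℝ} (ht : 0 < t) {n' : ℕ} (hn : n' ≤ 3) (i : ℕ) :
    ∫ u in Ioi (t ^ 2), u ^ ((n' : ℝ) - 11 / 2 - i)
      = 2 / ((((9 - 2 * n' + 2 * i : ℕ) : ℝ)) * t ^ (9 - 2 * n' + 2 * i)) := by
  have hn3 : (n' : ℝ) ≤ 3 := by exact_mod_cast hn
  have hi0 : (0 : ℝ) ≤ i := Nat.cast_nonneg i
  have ha : (n' : ℝ) - 11 / 2 - i < -1 := by linarith
  rw [integral_Ioi_rpow_of_lt ha (by positivity)]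
  have hk : ((9 - 2 * n' + 2 * i : ℕ) : ℝ) = 9 - 2 * (n' : ℝ) + 2 * i := by
    rw [Nat.cast_add, Nat.cast_sub (by omega)]; push_cast; ring
  have e1 : (t ^ 2) ^ ((n' : ℝ) - 11 / 2 - i + 1) = (t ^ (9 - 2 * n' + 2 * i))⁻¹ := by
    rw [← Real.rpow_two, ← Real.rpow_mul ht.le,
      show (2 : ℝ) * ((n' : ℝ) - 11 / 2 - i + 1) = -(((9 - 2 * n' + 2 * i : ℕ) : ℝ)) by rw [hk]; ring,
      Real.rpow_neg ht.le, Real.rpow_natCast]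
  rw [e1, hk, show (n' : ℝ) - 11 / 2 - i + 1 = -((9 - 2 * (n' : ℝ) + 2 * i) / 2) by ring]
  have hne' : (9 : ℝ) - 2 * (n' : ℝ) + 2 * i ≠ 0 := by linarith
  have htk : t ^ (9 - 2 * n' + 2 * i) ≠ 0 := pow_ne_zero _ ht.ne'
  field_simp

/-- `u^{n'} ∏_μ q_u(x_μ) = ((2π)^5 √(2π))⁻¹ · u^{n'}/(u^5 √u) · ∏_μ (√(2πu) q_u(x_μ))` (`u > 0`). [folklore] -/
theorem integrand_eq {u : ℝ} (hu : 0 < u) (n' : ℕ) (x : Fin 11 → ℤ) :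
    u ^ n' * ∏ μ : Fin 11, srwHeatKernel u (x μ)
      = ((2 * π) ^ 5 * √(2 * π))⁻¹ * (u ^ n' / (u ^ 5 * √u))
        * ∏ μ : Fin 11, (√(2 * π * u) * srwHeatKernel u (x μ)) := by
  have hs : √(2 * π * u) = √(2 * π) * √u := Real.sqrt_mul (by positivity) u
  have h11 : ∀ y : ℝ, 0 ≤ y → √y ^ 11 = y ^ 5 * √y := fun y hy => by
    rw [show (11 : ℕ) = 2 * 5 + 1 by norm_num, pow_succ, pow_mul, Real.sq_sqrt hy]
  rw [prod_mul_distrib, prod_const, card_univ, Fintype.card_fin, hs, mul_pow (√(2 * π)) (√u) 11,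
    h11 _ (by positivity), h11 _ hu.le]
  have h1 : (0 : ℝ) < (2 * π) ^ 5 * √(2 * π) := by positivity
  have h2 : (0 : ℝ) < u ^ 5 * √u := by positivity
  field_simp

namespace Cert

variable (c : Cert) {x : Fin 11 → ℤ}

/-- The real form of `tailOf pl (n'+1)`. [folklore] -/
theorem tailOf_real (pl : List ℕ × List ℕ) (hl : pl.1.length = pl.2.length) {n' : ℕ} (hn : n' ≤ 3) :
    ((c.tailOf pl (n' + 1) : ℚ) : ℝ) = ∑ i ∈ range pl.1.length,
      ((((pl.1.getD i 0 : ℕ) : ℝ) - ((pl.2.getD i 0 : ℕ) : ℝ)) / (2 : ℝ) ^ (11 * c.S))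
        * (2 / ((((9 - 2 * n' + 2 * i : ℕ) : ℝ)) * (c.t : ℝ) ^ (9 - 2 * n' + 2 * i))) := by
  rw [Cert.tailOf, tailInt_eq _ _ _ hl, Cert.scale, show 11 - 2 * (n' + 1) = 9 - 2 * n' by omega]
  push_cast
  rw [Finset.sum_div]
  refine sum_congr rfl fun i _ => ?_
  ring

/-- **The `[T,∞)` block**: `kLo · IL ≤ ∫_{T}^∞ u^{n'} ∏_μ q_u(x_μ) du ≤ kHi · IU`. [folklore] -/
theorem ioi_block (hp : c.Params) (hcs : ∀ i, coordD x i = ((c.avals.getD i 0 : ℕ) : ℤ))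
    (n' : ℕ) (hn : n' ≤ 3) :
    ((c.kLo : ℚ) : ℝ) * ((c.IL (n' + 1) : ℚ) : ℝ)
        ≤ ∫ u in Ioi ((c.t : ℝ) ^ 2), u ^ n' * ∏ μ : Fin 11, srwHeatKernel u (x μ) ∧
      ∫ u in Ioi ((c.t : ℝ) ^ 2), u ^ n' * ∏ μ : Fin 11, srwHeatKernel u (x μ)
        ≤ ((c.kHi : ℚ) : ℝ) * ((c.IU (n' + 1) : ℚ) : ℝ) := by
  have ht : (0 : ℝ) < (c.t : ℝ) := by exact_mod_cast hp.t_pos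
  have hT0 : (0 : ℝ) < (c.t : ℝ) ^ 2 := by positivity
  set κ : ℝ := ((2 * π) ^ 5 * √(2 * π))⁻¹ with hκ
  have hκ0 : 0 < κ := by positivity
  -- the true integrand and its polynomial minorant / majorant
  set g : ℝ → ℝ := fun u => u ^ n' * ∏ μ : Fin 11, srwHeatKernel u (x μ) with hg
  set cL : ℕ → ℝ := fun i =>
    (((c.plPN.1.getD i 0 : ℕ) : ℝ) - ((c.plPN.2.getD i 0 : ℕ) : ℝ)) / (2 : ℝ) ^ (11 * c.S) with hcL
  set cU : ℕ → ℝ := fun i =>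
    (((c.puPN.1.getD i 0 : ℕ) : ℝ) - ((c.puPN.2.getD i 0 : ℕ) : ℝ)) / (2 : ℝ) ^ (11 * c.S) with hcU
  set fL : ℝ → ℝ := fun u => ∑ i ∈ range c.plPN.1.length, κ * cL i * u ^ ((n' : ℝ) - 11 / 2 - i)
    with hfL
  set fU : ℝ → ℝ := fun u => ∑ i ∈ range c.puPN.1.length, κ * cU i * u ^ ((n' : ℝ) - 11 / 2 - i)
    with hfU
  have hlenL : c.plPN.1.length = c.plPN.2.length := length_loProdPN c.J c.eps c.S c.avals
  have hlenU : c.puPN.1.length = c.puPN.2.length := length_upProdPN c.J c.eps c.S c.avals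
  -- pointwise identities for `u > T`
  have hfL_eq : ∀ u, (c.t : ℝ) ^ 2 < u → fL u = κ * (u ^ n' / (u ^ 5 * √u))
      * ((toPolyN c.plPN.1 - toPolyN c.plPN.2).eval (1 / u) / (2 : ℝ) ^ (11 * c.S)) := by
    intro u hu
    have hu0 : 0 < u := hT0.trans hu
    simp only [hfL]
    rw [eval_pair_sub _ _ hlenL, Finset.sum_div, Finset.mul_sum]
    refine sum_congr rfl fun i _ => ?_
    rw [hcL, ← rpow_combine hu0 n' i]
    ring
  have hfU_eq : ∀ u, (c.t : ℝ) ^ 2 < u → fU u = κ * (u ^ n' / (u ^ 5 * √u))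
      * ((toPolyN c.puPN.1 - toPolyN c.puPN.2).eval (1 / u) / (2 : ℝ) ^ (11 * c.S)) := by
    intro u hu
    have hu0 : 0 < u := hT0.trans hu
    simp only [hfU]
    rw [eval_pair_sub _ _ hlenU, Finset.sum_div, Finset.mul_sum]
    refine sum_congr rfl fun i _ => ?_
    rw [hcU, ← rpow_combine hu0 n' i]
    ring
  have hg_eq : ∀ u, (c.t : ℝ) ^ 2 < u → g u = κ * (u ^ n' / (u ^ 5 * √u))
      * ∏ μ : Fin 11, (√(2 * π * u) * srwHeatKernel u (x μ)) := by
    intro u hu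
    simp only [hg]
    exact integrand_eq (hT0.trans hu) n' x
  have hle : ∀ u ∈ Ioi ((c.t : ℝ) ^ 2), fL u ≤ g u ∧ g u ≤ fU u ∧ 0 ≤ fL u := by
    intro u hu
    rw [Set.mem_Ioi] at hu
    have hu0 : 0 < u := hT0.trans hu
    obtain ⟨h1, h2, h3⟩ := c.prod_bracket hp hcs hu.le
    have hfac : 0 ≤ κ * (u ^ n' / (u ^ 5 * √u)) := by positivity
    rw [hfL_eq u hu, hfU_eq u hu, hg_eq u hu]
    exact ⟨mul_le_mul_of_nonneg_left h1 hfac, mul_le_mul_of_nonneg_left h2 hfac,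
      mul_nonneg hfac h3⟩
  -- integrability
  have hn3 : (n' : ℝ) ≤ 3 := by exact_mod_cast hn
  have hintpow : ∀ i : ℕ, IntegrableOn (fun u : ℝ => u ^ ((n' : ℝ) - 11 / 2 - i)) (Ioi ((c.t : ℝ) ^ 2)) := by
    intro i
    have hi0 : (0 : ℝ) ≤ i := Nat.cast_nonneg i
    exact integrableOn_Ioi_rpow_of_lt (by linarith) hT0
  have hfL_int : IntegrableOn fL (Ioi ((c.t : ℝ) ^ 2)) := by
    rw [hfL]
    refine integrable_finsetSum _ fun i _ => ?_
    exact (hintpow i).const_mul _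
  have hfU_int : IntegrableOn fU (Ioi ((c.t : ℝ) ^ 2)) := by
    rw [hfU]
    refine integrable_finsetSum _ fun i _ => ?_
    exact (hintpow i).const_mul _
  have hg_cont : Continuous g := by
    rw [hg]
    exact (continuous_id.pow n').mul
      (continuous_finsetProd _ fun μ _ => continuous_srwHeatKernel_left (x μ))
  have hg_int : IntegrableOn g (Ioi ((c.t : ℝ) ^ 2)) := by
    refine Integrable.mono' hfU_int hg_cont.aestronglyMeasurable ?_
    refine ae_restrict_of_forall_mem measurableSet_Ioi fun u hu => ?_
    obtain ⟨h1, h2, h3⟩ := hle u hu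
    rw [Real.norm_eq_abs, abs_of_nonneg (h3.trans h1)]
    exact h2
  -- the integrals of the minorant / majorant
  have hIL : ∫ u in Ioi ((c.t : ℝ) ^ 2), fL u = κ * ((c.IL (n' + 1) : ℚ) : ℝ) := by
    rw [hfL, integral_finsetSum _ (fun i _ => (hintpow i).const_mul _)]
    simp_rw [integral_const_mul, integral_rpow_tail ht hn]
    rw [Cert.IL, c.tailOf_real c.plPN hlenL hn, Finset.mul_sum]
    refine sum_congr rfl fun i _ => ?_
    rw [hcL]; ring
  have hIU : ∫ u in Ioi ((c.t : ℝ) ^ 2), fU u = κ * ((c.IU (n' + 1) : ℚ) : ℝ) := by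
    rw [hfU, integral_finsetSum _ (fun i _ => (hintpow i).const_mul _)]
    simp_rw [integral_const_mul, integral_rpow_tail ht hn]
    rw [Cert.IU, c.tailOf_real c.puPN hlenU hn, Finset.mul_sum]
    refine sum_congr rfl fun i _ => ?_
    rw [hcU]; ring
  have hlowI : κ * ((c.IL (n' + 1) : ℚ) : ℝ) ≤ ∫ u in Ioi ((c.t : ℝ) ^ 2), g u := by
    rw [← hIL]
    exact setIntegral_mono_on hfL_int hg_int measurableSet_Ioi fun u hu => (hle u hu).1
  have hupI : ∫ u in Ioi ((c.t : ℝ) ^ 2), g u ≤ κ * ((c.IU (n' + 1) : ℚ) : ℝ) := by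
    rw [← hIU]
    exact setIntegral_mono_on hg_int hfU_int measurableSet_Ioi fun u hu => (hle u hu).2.1
  have hIL0 : 0 ≤ ((c.IL (n' + 1) : ℚ) : ℝ) := by
    have h0 : 0 ≤ ∫ u in Ioi ((c.t : ℝ) ^ 2), fL u :=
      setIntegral_nonneg measurableSet_Ioi fun u hu => (hle u hu).2.2
    rw [hIL] at h0
    by_contra hneg
    push Not at hneg
    have := mul_neg_of_pos_of_neg hκ0 hneg
    linarith
  have hIU0 : 0 ≤ ((c.IU (n' + 1) : ℚ) : ℝ) := by
    have h0 : 0 ≤ ∫ u in Ioi ((c.t : ℝ) ^ 2), g u :=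
      setIntegral_nonneg measurableSet_Ioi fun u hu => (hle u hu).2.2.trans (hle u hu).1
    have h1 := h0.trans hupI
    by_contra hneg
    push Not at hneg
    have := mul_neg_of_pos_of_neg hκ0 hneg
    linarith
  -- the `(2π)^{-11/2}` brackets
  have hsHi : √(2 * π) ≤ ((c.sHi : ℚ) : ℝ) := by
    have h1 : 2 * π ≤ ((c.sHi : ℚ) : ℝ) ^ 2 := by
      have h2 : ((2 * piHi : ℚ) : ℝ) ≤ ((c.sHi ^ 2 : ℚ) : ℝ) := by exact_mod_cast hp.sHi_sq
      push_cast at h2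
      linarith [(show Real.pi < ((piHi : ℚ) : ℝ) from Literature.NumberTheory.LFunctions.lt_piHi20)]
    calc √(2 * π) ≤ √(((c.sHi : ℚ) : ℝ) ^ 2) := Real.sqrt_le_sqrt h1
      _ = ((c.sHi : ℚ) : ℝ) := Real.sqrt_sq (by exact_mod_cast hp.sHi_pos.le)
  have hsLo : ((c.sLo : ℚ) : ℝ) ≤ √(2 * π) := by
    have h1 : ((c.sLo : ℚ) : ℝ) ^ 2 ≤ 2 * π := by
      have h2 : ((c.sLo ^ 2 : ℚ) : ℝ) ≤ ((2 * piLo : ℚ) : ℝ) := by exact_mod_cast hp.sLo_sq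
      push_cast at h2
      linarith [(show ((piLo : ℚ) : ℝ) < Real.pi from Literature.NumberTheory.LFunctions.piLo20_lt)]
    calc ((c.sLo : ℚ) : ℝ) = √(((c.sLo : ℚ) : ℝ) ^ 2) :=
          (Real.sqrt_sq (by exact_mod_cast hp.sLo_pos.le)).symm
      _ ≤ √(2 * π) := Real.sqrt_le_sqrt h1
  have hpiHi0 : (0 : ℝ) < ((piHi : ℚ) : ℝ) := lt_trans Real.pi_pos (show Real.pi < ((piHi : ℚ) : ℝ) from Literature.NumberTheory.LFunctions.lt_piHi20)
  have hpiLo0 : (0 : ℝ) < ((piLo : ℚ) : ℝ) := piLo_pos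
  have hsHi0 : (0 : ℝ) < ((c.sHi : ℚ) : ℝ) := by exact_mod_cast hp.sHi_pos
  have hkLo : ((c.kLo : ℚ) : ℝ) ≤ κ := by
    rw [Cert.kLo, hκ]; push_cast
    rw [← one_div]
    apply one_div_le_one_div_of_le (by positivity)
    apply mul_le_mul _ hsHi (by positivity) (by positivity)
    apply pow_le_pow_left₀ (by positivity)
    linarith [(show Real.pi < ((piHi : ℚ) : ℝ) from Literature.NumberTheory.LFunctions.lt_piHi20)]
  have hkHi : κ ≤ ((c.kHi : ℚ) : ℝ) := by
    rw [Cert.kHi, hκ]; push_cast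
    rw [← one_div]
    have hsLo0 : (0 : ℝ) < ((c.sLo : ℚ) : ℝ) := by exact_mod_cast hp.sLo_pos
    apply one_div_le_one_div_of_le (by positivity)
    apply mul_le_mul _ hsLo hsLo0.le (by positivity)
    apply pow_le_pow_left₀ (by positivity)
    linarith [(show ((piLo : ℚ) : ℝ) < Real.pi from Literature.NumberTheory.LFunctions.piLo20_lt)]
  constructor
  · calc ((c.kLo : ℚ) : ℝ) * ((c.IL (n' + 1) : ℚ) : ℝ) ≤ κ * ((c.IL (n' + 1) : ℚ) : ℝ) :=
          mul_le_mul_of_nonneg_right hkLo hIL0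
      _ ≤ _ := hlowI
  · calc ∫ u in Ioi ((c.t : ℝ) ^ 2), g u ≤ κ * ((c.IU (n' + 1) : ℚ) : ℝ) := hupI
      _ ≤ ((c.kHi : ℚ) : ℝ) * ((c.IU (n' + 1) : ℚ) : ℝ) := mul_le_mul_of_nonneg_right hkHi hIU0

/-! ### The soundness theorem -/

/-- **Soundness of the SEEDCERT certificate**: if the four Boolean checks hold, then for the
lattice point `x ∈ ℤ¹¹` whose coordinates are the certificate's `avals`,
`lo n ≤ I_{n,0}(x; 11) ≤ hi n` for `n = 1, …, 4`. [folklore] -/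
theorem sound (h1 : c.paramsOK = true) (h2 : c.poissonCheck = true) (h3 : c.tailCheck = true)
    (h4 : c.finalCheck = true) (x : Fin 11 → ℤ)
    (hcs : ∀ i, coordD x i = ((c.avals.getD i 0 : ℕ) : ℤ)) (n : ℕ) (hn1 : 1 ≤ n) (hn4 : n ≤ 4) :
    ((c.lo n : ℚ) : ℝ) ≤ srwI 11 n 0 x ∧ srwI 11 n 0 x ≤ ((c.hi n : ℚ) : ℝ) := by
  have hp := c.params_of_paramsOK h1
  obtain ⟨n', rfl⟩ : ∃ n', n = n' + 1 := ⟨n - 1, by omega⟩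
  have hn : n' ≤ 3 := by omega
  have hT : (0 : ℝ) ≤ (c.t : ℝ) ^ 2 := by positivity
  have hsplit := srwI_succ_zero_eq_integral_Ioc_add_integral_Ioi n' (by omega : 2 * n' + 3 ≤ 11) x hT
  push_cast at hsplit
  obtain ⟨hB0lo, hB0hi⟩ := c.ioc_block hp hcs n' hn
  obtain ⟨hB1lo, hB1hi⟩ := c.ioi_block hp hcs n' hn
  obtain ⟨hPlo, hPhi, hUlo, hUhi⟩ := c.poissonCheck_spec h2 (n' + 1) (by omega) (by omega)
  obtain ⟨hILlo, hIUhi⟩ := c.tailCheck_spec h3 (n' + 1) (by omega) (by omega)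
  obtain ⟨hu0, hil0, hlo, hhi⟩ := c.finalCheck_spec h4 (n' + 1) (by omega) (by omega)
  obtain ⟨hrlo, hrhi⟩ := exp_neg_nat_mem c.lam hp.eLo_nonneg
  have hrlo' : ((c.rLo : ℚ) : ℝ) ≤ Real.exp (-(c.lam : ℝ)) := by simpa [Cert.rLo] using hrlo
  have hrhi' : Real.exp (-(c.lam : ℝ)) ≤ ((c.rHi : ℚ) : ℝ) := by simpa [Cert.rHi] using hrhi
  -- casts of the rational facts
  have qPlo : ((c.pLo (n' + 1) : ℚ) : ℝ) ≤ ((c.Pq c.what (n' + 1) : ℚ) : ℝ) := by exact_mod_cast hPlo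
  have qPhi : ((c.Pq c.what (n' + 1) : ℚ) : ℝ) ≤ ((c.pHi (n' + 1) : ℚ) : ℝ) := by exact_mod_cast hPhi
  have qUlo : ((c.uLo (n' + 1) : ℚ) : ℝ) ≤ ((c.Uq c.what (n' + 1) : ℚ) : ℝ) := by exact_mod_cast hUlo
  have qUhi : ((c.Uq c.what (n' + 1) : ℚ) : ℝ) ≤ ((c.uHi (n' + 1) : ℚ) : ℝ) := by exact_mod_cast hUhi
  have qILlo : ((c.ilLo (n' + 1) : ℚ) : ℝ) ≤ ((c.IL (n' + 1) : ℚ) : ℝ) := by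
    rw [Cert.IL]; exact_mod_cast hILlo
  have qIUhi : ((c.IU (n' + 1) : ℚ) : ℝ) ≤ ((c.iuHi (n' + 1) : ℚ) : ℝ) := by
    rw [Cert.IU]; exact_mod_cast hIUhi
  have qu0 : (0 : ℝ) ≤ ((c.uLo (n' + 1) : ℚ) : ℝ) := by exact_mod_cast hu0
  have qil0 : (0 : ℝ) ≤ ((c.ilLo (n' + 1) : ℚ) : ℝ) := by exact_mod_cast hil0
  have qlo : ((c.lo (n' + 1) : ℚ) : ℝ) ≤ ((c.loFinal (n' + 1) : ℚ) : ℝ) := by exact_mod_cast hlo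
  have qhi : ((c.hiFinal (n' + 1) : ℚ) : ℝ) ≤ ((c.hi (n' + 1) : ℚ) : ℝ) := by exact_mod_cast hhi
  rw [Cert.loFinal, Cert.pref] at qlo
  rw [Cert.hiFinal, Cert.pref] at qhi
  push_cast at qlo qhi
  -- signs
  have he0 : 0 ≤ Real.exp (-(c.lam : ℝ)) := Real.exp_nonneg _
  have hU0 : 0 ≤ ((c.Uq c.what (n' + 1) : ℚ) : ℝ) := qu0.trans qUlo
  have hkLo0 : 0 ≤ ((c.kLo : ℚ) : ℝ) := by
    rw [Cert.kLo]; push_cast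
    have : (0 : ℝ) < ((piHi : ℚ) : ℝ) := lt_trans Real.pi_pos (show Real.pi < ((piHi : ℚ) : ℝ) from Literature.NumberTheory.LFunctions.lt_piHi20)
    have : (0 : ℝ) < ((c.sHi : ℚ) : ℝ) := by exact_mod_cast hp.sHi_pos
    positivity
  have hkHi0 : 0 ≤ ((c.kHi : ℚ) : ℝ) := by
    rw [Cert.kHi]; push_cast
    have := piLo_pos
    have : (0 : ℝ) < ((c.sLo : ℚ) : ℝ) := by exact_mod_cast hp.sLo_pos
    positivity
  have hpref0 : (0 : ℝ) ≤ (11 : ℝ) ^ (n' + 1) / (n' ! : ℝ) := by positivity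
  -- product facts for `linarith`
  have hA : Real.exp (-(c.lam : ℝ)) * ((c.Uq c.what (n' + 1) : ℚ) : ℝ)
      ≤ ((c.rHi : ℚ) : ℝ) * ((c.uHi (n' + 1) : ℚ) : ℝ) :=
    mul_le_mul hrhi' qUhi hU0 (he0.trans hrhi')
  have hB : ((c.rLo : ℚ) : ℝ) * ((c.uLo (n' + 1) : ℚ) : ℝ)
      ≤ Real.exp (-(c.lam : ℝ)) * ((c.Uq c.what (n' + 1) : ℚ) : ℝ) :=
    mul_le_mul hrlo' qUlo qu0 he0
  have hC : (11 : ℝ) ^ (n' + 1) / (n' ! : ℝ) * (((c.kLo : ℚ) : ℝ) * ((c.ilLo (n' + 1) : ℚ) : ℝ))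
      ≤ (11 : ℝ) ^ (n' + 1) / (n' ! : ℝ)
        * ∫ u in Ioi ((c.t : ℝ) ^ 2), u ^ n' * ∏ μ : Fin 11, srwHeatKernel u (x μ) := by
    apply mul_le_mul_of_nonneg_left _ hpref0
    exact (mul_le_mul_of_nonneg_left qILlo hkLo0).trans hB1lo
  have hD : (11 : ℝ) ^ (n' + 1) / (n' ! : ℝ)
        * ∫ u in Ioi ((c.t : ℝ) ^ 2), u ^ n' * ∏ μ : Fin 11, srwHeatKernel u (x μ)
      ≤ (11 : ℝ) ^ (n' + 1) / (n' ! : ℝ) * (((c.kHi : ℚ) : ℝ) * ((c.iuHi (n' + 1) : ℚ) : ℝ)) := by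
    apply mul_le_mul_of_nonneg_left _ hpref0
    exact hB1hi.trans (mul_le_mul_of_nonneg_left qIUhi hkHi0)
  rw [hsplit]
  constructor <;> linarith

end Cert

end Literature.Probability.FitznerVanDerHofstad2017.SeedCert
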